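import Summits.AnomalousDissipation.AnomalousDissipation.Theorems.BaireTransferRobustLoudUpgradeStubSteadyPersist
import Summits.AnomalousDissipation.AnomalousDissipation.Theorems.BaireTransferRobustLoudUpgradeStubLsFamilyDist
import Literature.Analysis.FluidPDE.SteadyNSLatticeLinearised
import Literature.Analysis.FluidPDE.EulerReynolds
import Literature.Analysis.FunctionSpaces.TorusLerayHelmholtz

/-!
# Stub `stub_lsFamily` of the line `malkin-cone-group-orbits` (crux stmt-AnomalousDissipation-1144, companion c2),
# part A: lattice realisation of admissible fields and of corrected forces

Helper layer for the Lyapunov–Schmidt family of a simply degenerate steady state (assembled in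
`…StubLsFamilyB.lean`), over the steady Fourier lattice of
`Literature/Analysis/FluidPDE/SteadyNSLatticePersistence.lean` (state space `W ⊂ ℓ²(ℤ³; ℂ³)` of families
vanishing at `0`, transversal, conjugate symmetric; states carry the weight `|k|²`, `cf x = |k|⁻² x = û`):

* `exists_stateVec` — the STATE vector `x ∈ W` (`cf x = 𝓕(complexify ∘ u)`) of a smooth divergence-free mean-zero
  real field (pattern of `SteadyLattice.exists_dirDerivVec`);
* `exists_coeffVec` — the COEFFICIENT vector `e ∈ W` (`e = 𝓕(complexify ∘ h)` coordinatewise, no weight) of such a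
  field — the external border vector of the bordered implicit function theorem;
* `lerayCoeff_coeff` — the Leray multiplier fixes the coefficients of such a field;
* `isSmooth_sub_smul`, `isDivFree_sub_smul`, `hasZeroMean_sub_smul`, `mFourierCoeff_sub_smul` — the corrected force
  `f − s h` is admissible, with coefficients `f̂ − s ĥ`;
* `cf_sub_eq` — `cf (x − x₀) = 𝓕(complexify ∘ (u' − u₀))` from `cf x = 𝓕u'`, `cf x₀ = 𝓕u₀`;
* `latticeDist_eq_norm_sq` — the classical weighted distance `∑ |k|⁴ ‖û'(k) − û₀(k)‖²` is `‖x − x₀‖²`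
  (through the registered part lemma `LsFamilyDist.lsFamily_latticeDist`).

Pure proof file (no definitions).  References: Temam 1979 Ch. II §1; Vanderbauwhede 1982 Ch. 8.
-/

-- `Summit.<Summit>.<Problem>` is the tree's mandated summit-side namespace (CONVENTIONS §2); for this
-- single-conjunct summit the two coincide, so the duplicate is deliberate.
set_option linter.dupNamespace false

noncomputable section

open scoped BigOperators Topology ENNReal NNReal InnerProductSpace ComplexConjugate
open Filter Set Function TopologicalSpace MeasureTheory UnitAddTorus

namespace Summit.AnomalousDissipation.AnomalousDissipation.Theorems.RobustLoudUpgrade.LsFamily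

open Literature.Analysis.FunctionSpaces Literature.Analysis.FunctionSpaces.Torus
open Literature.Analysis.FunctionSpaces.EuclideanSpace
open Literature.Analysis.FluidPDE
open Literature.Analysis.FluidPDE.ScalarFourier
open Literature.Analysis.FluidPDE.SteadyLattice

/-! ## §1 Admissible fields: coefficients, Leray multiplier, corrected forces -/

section Fields

variable {u h f : UnitAddTorus (Fin 3) → EuclideanSpace ℝ (Fin 3)}

/-- The Fourier coefficients of a smooth divergence-free mean-zero real field vanish at `0`, are transversal and
conjugate symmetric. [folklore] -/
theorem coeff_admissible (hu : IsSmooth u) (hdiv : IsDivFree u) (h0 : HasZeroMean u) :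
    mFourierCoeff (complexify ∘ u) 0 = 0 ∧
      (∀ k : Fin 3 → ℤ, (∑ jj : Fin 3, ((k jj : ℤ) : ℂ) * (mFourierCoeff (complexify ∘ u) k) jj) = 0) ∧
      IsConjSymm (mFourierCoeff (complexify ∘ u)) :=
  ⟨mFourierCoeff_complexify_zero_of_hasZeroMean hu h0, fun k => hdiv.sum_mul_mFourierCoeff_eq_zero hu k,
    isConjSymm_mFourierCoeff hu.integrable⟩

/-- **The Leray multiplier fixes the coefficients of a smooth divergence-free mean-zero real field.** [folklore] -/
theorem lerayCoeff_coeff (hu : IsSmooth u) (hdiv : IsDivFree u) (h0 : HasZeroMean u) (k : Fin 3 → ℤ) :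
    Torus.lerayCoeff k (mFourierCoeff (complexify ∘ u) k) = mFourierCoeff (complexify ∘ u) k := by
  obtain ⟨hz, ht, -⟩ := coeff_admissible hu hdiv h0
  by_cases hk : k = 0
  · subst hk; rw [hz, lerayCoeff_zero_vec]
  · exact lerayCoeff_of_kdot_eq_zero hk (ht k)

/-- `f − s h` is smooth. [folklore] -/
theorem isSmooth_sub_smul (hf : IsSmooth f) (hh : IsSmooth h) (s : ℝ) : IsSmooth (fun y => f y - s • h y) :=
  hf.sub (hh.const_smul s)

/-- `f − s h` is divergence free. [folklore] -/
theorem isDivFree_sub_smul (hf : IsSmooth f) (hh : IsSmooth h) (hfd : IsDivFree f) (hhd : IsDivFree h) (s : ℝ) :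
    IsDivFree (fun y => f y - s • h y) := by
  intro x
  have h1 : (fun y => f y - s • h y) = f - s • h := by funext y; simp
  rw [h1, divergence_sub (hf.isContDiff (by simp)) ((hh.smul s).isContDiff (by simp)) x,
    Literature.Analysis.FluidPDE.Torus.divergence_const_smul (hh.isContDiff (by simp)) s x, hfd x, hhd x, mul_zero,
    sub_zero]

/-- `f − s h` has zero mean. [folklore] -/
theorem hasZeroMean_sub_smul (hf : IsSmooth f) (hh : IsSmooth h) (hf0 : HasZeroMean f) (hh0 : HasZeroMean h)
    (s : ℝ) : HasZeroMean (fun y => f y - s • h y) := by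
  unfold HasZeroMean at hf0 hh0 ⊢
  have hi : Integrable (fun x => s • h x) := hh.integrable.smul s
  show (∫ x, (f x - s • h x)) = 0
  rw [integral_sub hf.integrable hi, integral_smul, hf0, hh0, smul_zero, sub_zero]

/-- Coefficients of the corrected force: `𝓕(f − s h) = 𝓕f − s 𝓕h`. [folklore] -/
theorem mFourierCoeff_sub_smul (hf : IsSmooth f) (hh : IsSmooth h) (s : ℝ) (k : Fin 3 → ℤ) :
    mFourierCoeff (complexify ∘ fun y => f y - s • h y) k =
      mFourierCoeff (complexify ∘ f) k - (s : ℂ) • mFourierCoeff (complexify ∘ h) k := by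
  have e : (complexify ∘ fun y => f y - s • h y) = (complexify ∘ f) - (s : ℂ) • (complexify ∘ h) := by
    funext y
    simp only [Function.comp_apply, Pi.sub_apply, Pi.smul_apply, map_sub, coe_smul_complexify]
  rw [e, mFourierCoeff_sub hf.complexify_comp.integrable (hh.complexify_comp.integrable.smul (s : ℂ)),
    mFourierCoeff_const_smul]

end Fields

/-! ## §2 State and coefficient vectors in the lattice space `W` -/

section Vectors

variable {W : Submodule ℝ (lp (fun _ : Fin 3 → ℤ => EuclideanSpace ℂ (Fin 3)) 2)}
  (hW : ∀ x : (lp (fun _ : Fin 3 → ℤ => EuclideanSpace ℂ (Fin 3)) 2), x ∈ W ↔ ((x : (Fin 3 → ℤ) → (EuclideanSpace ℂ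
      (Fin 3))) 0 = 0 ∧ (∀ k : (Fin 3 → ℤ), (∑ jj : Fin 3, ((k jj : ℤ) : ℂ) * ((x : (Fin 3 → ℤ) → (EuclideanSpace ℂ
      (Fin 3))) k) jj) = 0) ∧
    IsConjSymm (x : (Fin 3 → ℤ) → (EuclideanSpace ℂ (Fin 3)))))
include hW

/-- **The state vector of an admissible field**: for a smooth divergence-free mean-zero real field `u`, the family
`k ↦ |k|² û(k)` is an element `x ∈ W` with `cf x = 𝓕(complexify ∘ u)` (pattern of `SteadyLattice.exists_dirDerivVec`).
[folklore] -/
theorem exists_stateVec {u : UnitAddTorus (Fin 3) → EuclideanSpace ℝ (Fin 3)} (hu : IsSmooth u) (hdiv : IsDivFree u)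
    (h0 : HasZeroMean u) :
    ∃ x : W, ((fun mm : Fin 3 → ℤ => (((freqNormSq mm)⁻¹ : ℝ) : ℂ)) • (((x : (lp (fun _ : Fin 3 → ℤ => EuclideanSpace
        ℂ (Fin 3)) 2)) : (Fin 3 → ℤ) → (EuclideanSpace ℂ (Fin 3))) : (Fin 3 → ℤ) → EuclideanSpace ℂ (Fin 3))) =
        mFourierCoeff (complexify ∘ u) := by
  obtain ⟨hV0, hVt, hVcs⟩ := coeff_admissible hu hdiv h0
  set V : (Fin 3 → ℤ) → (EuclideanSpace ℂ (Fin 3)) := mFourierCoeff (complexify ∘ u) with hV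
  have hVr : RapidDecay V := hu.complexify_comp.rapidDecay_mFourierCoeff
  set X : (Fin 3 → ℤ) → (EuclideanSpace ℂ (Fin 3)) := fun k => ((freqNormSq k : ℝ) : ℂ) • V k with hX
  have hXr : RapidDecay X := by
    refine hVr.of_norm_le_mul_pow (C := 1) (s := 1) fun k => ?_
    rw [hX]
    dsimp only
    rw [norm_smul, Complex.norm_real, Real.norm_of_nonneg (freqNormSq_nonneg k), one_mul, pow_one]
    exact mul_le_mul_of_nonneg_right (by linarith [freqNormSq_nonneg k]) (norm_nonneg _)
  have hXV : X 0 = 0 ∧ (∀ k : (Fin 3 → ℤ), (∑ jj : Fin 3, ((k jj : ℤ) : ℂ) * (X k) jj) = 0) ∧ IsConjSymm X := by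
    refine ⟨by simp [hX, freqNormSq_zero], fun k => by rw [hX]; dsimp only; rw [kdot_smul, hVt k, mul_zero],
      fun k => ?_⟩
    rw [hX]
    dsimp only
    rw [freqNormSq_neg, hVcs k, conjVec_smul, Complex.conj_ofReal]
  refine ⟨⟨⟨X, memℓp_two_of_rapidDecay hXr⟩, (hW _).2 hXV⟩, ?_⟩
  change ((fun mm : Fin 3 → ℤ => (((freqNormSq mm)⁻¹ : ℝ) : ℂ)) • (X : (Fin 3 → ℤ) → EuclideanSpace ℂ (Fin 3))) = V
  rw [hX]
  exact cf_weight_smul hV0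

/-- **The coefficient vector of an admissible field**: for a smooth divergence-free mean-zero real field `h`, the
family `𝓕(complexify ∘ h)` itself is an element `e ∈ W`. [folklore] -/
theorem exists_coeffVec {h : UnitAddTorus (Fin 3) → EuclideanSpace ℝ (Fin 3)} (hh : IsSmooth h) (hdiv : IsDivFree h)
    (h0 : HasZeroMean h) :
    ∃ e : W, ((e : (lp (fun _ : Fin 3 → ℤ => EuclideanSpace ℂ (Fin 3)) 2)) : (Fin 3 → ℤ) → (EuclideanSpace ℂ
        (Fin 3))) = mFourierCoeff (complexify ∘ h) := by
  have hr : RapidDecay (mFourierCoeff (complexify ∘ h)) := hh.complexify_comp.rapidDecay_mFourierCoeff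
  exact ⟨⟨⟨mFourierCoeff (complexify ∘ h), memℓp_two_of_rapidDecay hr⟩, (hW _).2 (coeff_admissible hh hdiv h0)⟩,
    rfl⟩

omit hW in
/-- **Difference of states**: if `cf x = 𝓕u'` and `cf x₀ = 𝓕u₀` for smooth fields, then
`𝓕(complexify ∘ (u' − u₀)) = cf (x − x₀)`. [folklore] -/
theorem cf_sub_eq {u' u₀ : UnitAddTorus (Fin 3) → EuclideanSpace ℝ (Fin 3)} (hu' : IsSmooth u') (hu₀ : IsSmooth u₀)
    (x x₀ : W)
    (hx : ((fun mm : Fin 3 → ℤ => (((freqNormSq mm)⁻¹ : ℝ) : ℂ)) • (((x : (lp (fun _ : Fin 3 → ℤ => EuclideanSpace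
        ℂ (Fin 3)) 2)) : (Fin 3 → ℤ) → (EuclideanSpace ℂ (Fin 3))) : (Fin 3 → ℤ) → EuclideanSpace ℂ (Fin 3))) =
        mFourierCoeff (complexify ∘ u'))
    (hx₀ : ((fun mm : Fin 3 → ℤ => (((freqNormSq mm)⁻¹ : ℝ) : ℂ)) • (((x₀ : (lp (fun _ : Fin 3 → ℤ =>
        EuclideanSpace ℂ (Fin 3)) 2)) : (Fin 3 → ℤ) → (EuclideanSpace ℂ (Fin 3))) : (Fin 3 → ℤ) → EuclideanSpace ℂ
        (Fin 3))) = mFourierCoeff (complexify ∘ u₀)) :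
    mFourierCoeff (complexify ∘ fun y => u' y - u₀ y) = ((fun mm : Fin 3 → ℤ => (((freqNormSq mm)⁻¹ : ℝ) :
      ℂ)) • ((((x - x₀ : W) : (lp (fun _ : Fin 3 → ℤ => EuclideanSpace ℂ (Fin 3)) 2)) : (Fin 3 → ℤ) → (EuclideanSpace ℂ
      (Fin 3))) : (Fin 3 → ℤ) → EuclideanSpace ℂ (Fin 3))) := by
  have e : (complexify ∘ fun y => u' y - u₀ y : (UnitAddTorus (Fin 3)) → (EuclideanSpace ℂ (Fin 3))) = (complexify
      ∘ u') - (complexify ∘ u₀) := by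
    funext y; simp
  rw [e, coeW_sub]
  funext k
  rw [mFourierCoeff_sub hu'.complexify_comp.integrable hu₀.complexify_comp.integrable, ← hx, ← hx₀]
  simp only [Pi.smul_apply', Pi.sub_apply, smul_sub]

/-- **The classical weighted distance is the lattice distance**: with `cf x = 𝓕u'`, `cf x₀ = 𝓕u₀`,
`∑ |k|⁴ ‖û'(k) − û₀(k)‖² = ‖x − x₀‖²` (registered part lemma `lsFamily_latticeDist`). [folklore] -/
theorem latticeDist_eq_norm_sq {u' u₀ : UnitAddTorus (Fin 3) → EuclideanSpace ℝ (Fin 3)} (hu' : IsSmooth u')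
    (hu₀ : IsSmooth u₀) (x x₀ : W)
    (hx : ((fun mm : Fin 3 → ℤ => (((freqNormSq mm)⁻¹ : ℝ) : ℂ)) • (((x : (lp (fun _ : Fin 3 → ℤ => EuclideanSpace
        ℂ (Fin 3)) 2)) : (Fin 3 → ℤ) → (EuclideanSpace ℂ (Fin 3))) : (Fin 3 → ℤ) → EuclideanSpace ℂ (Fin 3))) =
        mFourierCoeff (complexify ∘ u'))
    (hx₀ : ((fun mm : Fin 3 → ℤ => (((freqNormSq mm)⁻¹ : ℝ) : ℂ)) • (((x₀ : (lp (fun _ : Fin 3 → ℤ =>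
        EuclideanSpace ℂ (Fin 3)) 2)) : (Fin 3 → ℤ) → (EuclideanSpace ℂ (Fin 3))) : (Fin 3 → ℤ) → EuclideanSpace ℂ
        (Fin 3))) = mFourierCoeff (complexify ∘ u₀)) :
    (∑' k : Fin 3 → ℤ, freqNormSq k ^ 2 *
        ‖mFourierCoeff (complexify ∘ u') k - mFourierCoeff (complexify ∘ u₀) k‖ ^ 2) = ‖x - x₀‖ ^ 2 := by
  have hcf := cf_sub_eq hu' hu₀ x x₀ hx hx₀
  have hsub : ∀ k, mFourierCoeff (complexify ∘ u') k - mFourierCoeff (complexify ∘ u₀) k =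
      mFourierCoeff (complexify ∘ fun y => u' y - u₀ y) k := by
    intro k
    have e : (complexify ∘ fun y => u' y - u₀ y : (UnitAddTorus (Fin 3)) → (EuclideanSpace ℂ (Fin 3))) =
        (complexify ∘ u') - (complexify ∘ u₀) := by
      funext y; simp
    rw [e, mFourierCoeff_sub hu'.complexify_comp.integrable hu₀.complexify_comp.integrable]
  simp_rw [hsub]
  rw [← norm_coeW]
  exact LsFamilyDist.lsFamily_latticeDist _ _ (W_zero hW (x - x₀)) hcf.symm

end Vectors


/-! ## §3 The registered part-A sub-goal -/

/-- **Registered sub-goal `lsFamily_partA`** (part file of `stub_lsFamily`): the state vector of an admissible field,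
`exists_stateVec`, in Pi-form over the lattice space. [folklore] -/
theorem lsFamily_partA : ∀ (W : Submodule ℝ (lp (fun _ : Fin 3 → ℤ => EuclideanSpace ℂ (Fin 3)) 2)), (∀ x : lp (fun _ : Fin 3 → ℤ => EuclideanSpace ℂ (Fin 3)) 2, x ∈ W ↔ ((x : (Fin 3 → ℤ) → EuclideanSpace ℂ (Fin 3)) 0 = 0 ∧ (∀ k : Fin 3 → ℤ, (∑ jj : Fin 3, ((k jj : ℤ) : ℂ) * ((x : (Fin 3 → ℤ) → EuclideanSpace ℂ (Fin 3)) k) jj) = 0) ∧ IsConjSymm (x : (Fin 3 → ℤ) → EuclideanSpace ℂ (Fin 3)))) → ∀ (u : UnitAddTorus (Fin 3) → EuclideanSpace ℝ (Fin 3)), IsSmooth u → IsDivFree u → HasZeroMean u → ∃ x : W, ((fun mm : Fin 3 → ℤ => (((freqNormSq mm)⁻¹ : ℝ) : ℂ)) • (((x : lp (fun _ : Fin 3 → ℤ => EuclideanSpace ℂ (Fin 3)) 2) : (Fin 3 → ℤ) → EuclideanSpace ℂ (Fin 3)))) = mFourierCoeff (complexify ∘ u) :=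
  fun _ hW _ hu hdiv h0 => exists_stateVec hW hu hdiv h0

end Summit.AnomalousDissipation.AnomalousDissipation.Theorems.RobustLoudUpgrade.LsFamily

end
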